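import Literature.Barriers.RiemannHypothesis.TuranPartialSumsCheckSound
import HarnessLib

/-!
# Sections of `ζ` beyond `σ = 1`: certified zeros of `ζ_N`, `600 ≤ N ≤ 749`

Barrier catalogue `Literature/Barriers/RiemannHypothesis/`, companion of `TuranPartialSums.lean`.
Pure proof file (a kernel computation; nothing is defined or asserted): for every `N` with
`600 ≤ N ≤ 749`
the section `ζ_N(s) = ∑_{n ≤ N} n^{-s}` has a zero with `Re s > 1` — cases of Platt–Trudgian 2016,
Theorem 1.1 (ii) ("for all other positive `N` there are infinitely many such
zeroes"; there attributed to Spira 1968, van de Lune–te Riele 1982 and Monach 1980), here CERTIFIED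
BY THE KERNEL: `exists_zero_of_checkSegs` (`TuranPartialSumsCheckSound.lean`) applied to the
segments `(n₀, len, [(p, x, y, d), …])` below — for `n₀ ≤ N < n₀ + len` the primes `p` (all
`p ≤ √N` and possibly a few more) get the Gaussian phases `ω(p) = (x + iy)/d`, `x² + y² = d²`, all
larger primes are free — each `N` being verified by `check N 1 es` (the `σ = 1` criterion
`exists_zero_of_criterion` in exact arithmetic) through `decide +kernel` (standard axioms only;
`maxHeartbeats 0` lifts the deterministic time-out for the one declaration; a few minutes of kernel
time). The phases were found by floating-point optimisation and rounded to Pythagorean points; they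
carry no meaning beyond passing the check.

## References

* [PlattTrudgian2016] D. J. Platt, T. S. Trudgian, *Zeroes of partial sums of the zeta-function*,
  LMS J. Comput. Math. 19 (2016), 37–41, Thm. 1.1 and §1 (Table 1).
* [Spira1968] R. Spira, Math. Comp. 22 (1968), 163–173, §4 Table III (`N = 19, 23–27, 29–50`).
-/

namespace Literature.Barriers.RiemannHypothesis

open TuranCheck

set_option maxHeartbeats 0 in
/-- **Certified zeros of the sections `ζ_N`, `600 ≤ N ≤ 749`**: for every such `N` there is `s` with
`Re s > 1` and `ζ_N(s) = 0`. [cite: PlattTrudgian2016, Theorem 1.1] -/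
theorem exists_zero_of_certificate_600_749 (N : ℕ) (h₁ : 600 ≤ N) (h₂ : N < 750) :
    ∃ s : ℂ, 1 < s.re ∧ zetaPartialSum N s = 0 :=
  exists_zero_of_checkSegs (W := 1)
    (segs := [(600, 150,
        [(2, 65, 72, 97), (3, 7, 24, 25), (5, -9, 40, 41), (7, -8, 15, 17), (11, -72, 65, 97),
         (13, -4, 3, 5), (17, -80, 39, 89), (19, -12, 5, 13), (23, -24, 7, 25)])])
    (by decide +kernel) (by decide +kernel) N h₁ h₂

end Literature.Barriers.RiemannHypothesis
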